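import Literature.Topology.PlanarFoliations.CycleLeafPaths
import Literature.Topology.PlanarFoliations.HugWalk
import HarnessLib

/-!
# Pieces of two cycles along the same separatrix have homotopic images

Topic: Topology / PlanarFoliations, sequel to `WalkBuild.lean`, `PolygonLoop.lean` (the piece
`piece i` of the polygon of a cycle of separatrices: out-prong arc, leaf arc, in-prong arc),
`WalkLeafPaths.lean` / `CycleLeafPaths.lean` (their images as paths of `T.LeafSpace`). The
junction data of a cycle (tails, parameters `β`, the leaf arcs) are *chosen*; we prove that the
image in the leaf space of `T` of the piece between two saddles along a separatrix does not
depend on the choices, up to homotopy (`gPieceFin_homotopic_canon`, `gPieceFin_homotopic`): a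
piece is `OUT b · (PSEG · LINK · PSEG') · IN b'` for small parameters `b, b'` (sliding along the
prongs is a reparametrisation, `outP'_homotopic`, `inP'_homotopic`); the middle is `g ∘ ι` of a
path of `X` inside the closed leaf interval between the prong points over `b` and `b'`, hence a
reparametrisation of the Jordan arc of that interval (`exists_reparam_of_range_subset`, the arc
from `exists_leafIccPath`), so its image is homotopic to the image of that arc — which depends
only on the separatrix, the saddles, the prongs and `b, b'`.

All statements are [folklore].
-/

noncomputable section

open Set Filter Function Metric unitInterval
open _root_.Topology
open Literature.Topology.FourManifolds Literature.Topology.FourManifolds.Foliation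

namespace Literature.Topology.PlanarFoliations

/-! ## Reparametrising a path inside an injective path -/

section Reparam

variable {Y : Type*} [TopologicalSpace Y] [T2Space Y] {x y : Y}

/-- **A path inside the range of an injective path is a reparametrisation of it.** [folklore] -/
theorem exists_reparam_of_range_subset (γ₁ γ₂ : Path x y) (h₁ : Injective γ₁) (h : range γ₂ ⊆ range γ₁) :
    ∃ φ : I → I, Continuous φ ∧ φ 0 = 0 ∧ φ 1 = 1 ∧ ∀ t, γ₂ t = γ₁ (φ t) := by
  -- `γ₁` is a homeomorphism onto its range
  set e : I ≃ range γ₁ := Equiv.ofInjective γ₁ h₁ with he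
  have hec : Continuous e := γ₁.continuous.subtype_mk _
  set H : I ≃ₜ range γ₁ := hec.homeoOfEquivCompactToT2 (f := e) with hH
  set φ : I → I := fun t ↦ H.symm ⟨γ₂ t, h ⟨t, rfl⟩⟩ with hφ
  have hφc : Continuous φ := H.symm.continuous.comp (γ₂.continuous.subtype_mk _)
  have hval : ∀ t, γ₁ (φ t) = γ₂ t := fun t ↦ by
    have : (H (φ t) : Y) = γ₂ t := by rw [hφ]; simp only [Homeomorph.apply_symm_apply]
    exact this
  refine ⟨φ, hφc, h₁ ?_, h₁ ?_, fun t ↦ (hval t).symm⟩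
  · rw [hval, γ₁.source, γ₂.source]
  · rw [hval, γ₁.target, γ₂.target]

/-- Two paths related by a reparametrisation are homotopic. [folklore] -/
theorem Path.Homotopic.of_reparam {Z : Type*} [TopologicalSpace Z] {a b : Z} (p q : Path a b) {φ : I → I} (hφ : Continuous φ)
    (h0 : φ 0 = 0) (h1 : φ 1 = 1) (h : ∀ t, q t = p (φ t)) : p.Homotopic q := by
  have heq : q = p.reparam φ hφ h0 h1 := Path.ext (funext fun t ↦ h t)
  rw [heq]
  exact ⟨Path.Homotopy.reparam p φ hφ h0 h1⟩

end Reparam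

variable {X : Type*} [TopologicalSpace X] [T2Space X] [SecondCountableTopology X] [Nonempty X] {F : Foliation ℝ X} {ι : X → ℂ}
variable {B : Type*} [NormedAddCommGroup B] {M : Type*} [TopologicalSpace M] {T : Foliation B M} {g : ℂ → M}
variable {hbi : IsBiOriented F}

namespace StarData

variable (D : StarData F ι T g) (hι : IsOpenEmbedding ι)

/-! ## Prong paths in the leaf space and sliding along them -/

section Prong

variable {v : ℂ} (hv0 : D.nprong v ≠ 0) (j : ZMod (D.nprong v))

omit [T2Space X] [SecondCountableTopology X] [Nonempty X] in
/-- `g` of a prong path `θ ↦ pt j (b θ, 0)`, `b θ ∈ [0, ρ]`, is continuous into the leaf space of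
`T`. [folklore] -/
theorem continuous_pos_prong {b : I → ℝ} (hb : Continuous b) (hmem : ∀ θ, b θ ∈ Icc 0 (D.star v hv0).ρ) :
    Continuous (fun θ ↦ D.pos ((D.star v hv0).pt j (b θ, 0))) := by
  set P := D.star v hv0 with hP
  have hvP : v ∈ D.P := D.mem_P _ hv0
  have hrect : ∀ θ, ((b θ, 0) : ℝ × ℝ) ∈ P.rect := fun θ ↦ (P.mem_rect_iff).2 ⟨hmem θ, by simp [P.ρ_pos.le]⟩
  have hplaque : ∀ θ, g (P.pt j (b θ, 0)) ∈ plaque (D.box v) (D.level v v) := fun θ ↦ D.g_pt_mem_plaque hv0 j (hmem θ)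
  refine T.continuous_toLeafSpace_comp_of_forall_mem_plaque ?_ (D.box_mem _ hvP) hplaque
  have hc : Continuous fun θ ↦ P.pt j (b θ, 0) := (P.continuousOn_pt j).comp_continuous (hb.prodMk continuous_const) hrect
  exact D.continuousOn.comp_continuous hc fun θ ↦ D.ball_subset _ hvP (D.mem_ball_of_mem_S hv0 (P.pt_mem (hrect θ)))

/-- **The prong segment** from the parameter `c₁` to the parameter `c₂`, in the leaf space of `T`.
[folklore] -/
def psegP {c₁ c₂ : ℝ} (h₁ : c₁ ∈ Icc 0 (D.star v hv0).ρ) (h₂ : c₂ ∈ Icc 0 (D.star v hv0).ρ) :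
    Path (D.pos ((D.star v hv0).pt j (c₁, 0))) (D.pos ((D.star v hv0).pt j (c₂, 0))) where
  toFun θ := D.pos ((D.star v hv0).pt j (βline c₁ c₂ θ, 0))
  continuous_toFun := D.continuous_pos_prong hv0 j (by unfold βline; fun_prop) fun θ ↦ βline_mem h₁ h₂ θ
  source' := by simp only [βline_zero]
  target' := by simp only [βline_one]

omit [T2Space X] [SecondCountableTopology X] [Nonempty X] in
/-- The values of the prong segment. [folklore] -/
theorem psegP_apply {c₁ c₂ : ℝ} (h₁ : c₁ ∈ Icc 0 (D.star v hv0).ρ) (h₂ : c₂ ∈ Icc 0 (D.star v hv0).ρ) (θ : I) :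
    D.psegP hv0 j h₁ h₂ θ = D.pos ((D.star v hv0).pt j (βline c₁ c₂ θ, 0)) := rfl

/-- **The out-prong path to the parameter `c`**: `θ ↦ pt j (θ c, 0)`, from the puncture. [folklore] -/
def outP' {c : ℝ} (hc : c ∈ Icc 0 (D.star v hv0).ρ) : Path (D.pos v) (D.pos ((D.star v hv0).pt j (c, 0))) where
  toFun θ := D.pos ((D.star v hv0).pt j ((θ : ℝ) * c, 0))
  continuous_toFun := D.continuous_pos_prong hv0 j (by fun_prop) fun θ ↦
    ⟨mul_nonneg θ.2.1 hc.1, (mul_le_of_le_one_left hc.1 θ.2.2).trans hc.2⟩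
  source' := by simp only [Icc.coe_zero, zero_mul, Prod.mk_zero_zero, ProngStar.pt_zero]
  target' := by simp only [Icc.coe_one, one_mul]

/-- **The in-prong path from the parameter `c`**: `θ ↦ pt j ((1 - θ) c, 0)`, to the puncture.
[folklore] -/
def inP' {c : ℝ} (hc : c ∈ Icc 0 (D.star v hv0).ρ) : Path (D.pos ((D.star v hv0).pt j (c, 0))) (D.pos v) where
  toFun θ := D.pos ((D.star v hv0).pt j ((1 - (θ : ℝ)) * c, 0))
  continuous_toFun := D.continuous_pos_prong hv0 j (by fun_prop) fun θ ↦
    ⟨mul_nonneg (by linarith [θ.2.2]) hc.1, (mul_le_of_le_one_left hc.1 (by linarith [θ.2.1])).trans hc.2⟩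
  source' := by simp only [Icc.coe_zero, sub_zero, one_mul]
  target' := by simp only [Icc.coe_one, sub_self, zero_mul, Prod.mk_zero_zero, ProngStar.pt_zero]

omit [T2Space X] [SecondCountableTopology X] [Nonempty X] in
/-- The values of the out-prong path. [folklore] -/
theorem outP'_apply {c : ℝ} (hc : c ∈ Icc 0 (D.star v hv0).ρ) (θ : I) :
    D.outP' hv0 j hc θ = D.pos ((D.star v hv0).pt j ((θ : ℝ) * c, 0)) := rfl

omit [T2Space X] [SecondCountableTopology X] [Nonempty X] in
/-- The values of the in-prong path. [folklore] -/
theorem inP'_apply {c : ℝ} (hc : c ∈ Icc 0 (D.star v hv0).ρ) (θ : I) :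
    D.inP' hv0 j hc θ = D.pos ((D.star v hv0).pt j ((1 - (θ : ℝ)) * c, 0)) := rfl

omit [T2Space X] [SecondCountableTopology X] [Nonempty X] in
/-- **Sliding out**: the out-prong path to `c` is homotopic to the out-prong path to `b ≤ c`
followed by the prong segment from `b` to `c` (a reparametrisation). [folklore] -/
theorem outP'_homotopic {b c : ℝ} (hb : b ∈ Icc 0 (D.star v hv0).ρ) (hc : c ∈ Icc 0 (D.star v hv0).ρ) (hbc : b ≤ c) (hc0 : 0 < c) :
    (D.outP' hv0 j hc).Homotopic ((D.outP' hv0 j hb).trans (D.psegP hv0 j hb hc)) := by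
  -- the parameter of the concatenation, divided by `c`
  set val : I → ℝ := transFun (fun θ ↦ (θ : ℝ) * b) (fun θ ↦ βline b c θ) with hval
  have hvalc : Continuous val := continuous_transFun (by fun_prop) (by unfold βline; fun_prop) (by simp [βline])
  have hvalmem : ∀ θ, val θ ∈ Icc 0 c := fun θ ↦ by
    rw [hval]; unfold transFun
    split_ifs
    · exact ⟨mul_nonneg (fstHalf θ).2.1 hb.1, (mul_le_of_le_one_left hb.1 (fstHalf θ).2.2).trans hbc⟩
    · have := βline_mem (ρ := c) ⟨hb.1, hbc⟩ ⟨hc0.le, le_rfl⟩ (sndHalf θ); exact this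
  set φ : I → I := fun θ ↦ ⟨val θ / c, div_nonneg (hvalmem θ).1 hc0.le, (div_le_one hc0).2 (hvalmem θ).2⟩ with hφ
  refine Path.Homotopic.of_reparam _ _ (φ := φ) (by rw [hφ]; fun_prop) ?_ ?_ fun θ ↦ ?_
  · apply Subtype.ext; show val 0 / c = 0; rw [hval, transFun_zero]; simp
  · apply Subtype.ext; show val 1 / c = 1; rw [hval, transFun_one, βline_one, div_self hc0.ne']
  · rw [Path.trans_apply_eq_transFun, outP'_apply]
    show transFun (D.outP' hv0 j hb) (D.psegP hv0 j hb hc) θ = D.pos ((D.star v hv0).pt j (val θ / c * c, 0))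
    rw [div_mul_cancel₀ _ hc0.ne', hval]
    unfold transFun
    split_ifs <;> rfl

omit [T2Space X] [SecondCountableTopology X] [Nonempty X] in
/-- **Sliding in**: the in-prong path from `c` is homotopic to the prong segment from `c` to
`b ≤ c` followed by the in-prong path from `b`. [folklore] -/
theorem inP'_homotopic {b c : ℝ} (hb : b ∈ Icc 0 (D.star v hv0).ρ) (hc : c ∈ Icc 0 (D.star v hv0).ρ) (hbc : b ≤ c) (hc0 : 0 < c) :
    (D.inP' hv0 j hc).Homotopic ((D.psegP hv0 j hc hb).trans (D.inP' hv0 j hb)) := by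
  set val : I → ℝ := transFun (fun θ ↦ βline c b θ) (fun θ ↦ (1 - (θ : ℝ)) * b) with hval
  have hvalc : Continuous val := continuous_transFun (by unfold βline; fun_prop) (by fun_prop) (by simp [βline])
  have hvalmem : ∀ θ, val θ ∈ Icc 0 c := fun θ ↦ by
    rw [hval]; unfold transFun
    split_ifs
    · exact βline_mem (ρ := c) ⟨hc0.le, le_rfl⟩ ⟨hb.1, hbc⟩ (fstHalf θ)
    · exact ⟨mul_nonneg (by linarith [(sndHalf θ).2.2]) hb.1, (mul_le_of_le_one_left hb.1 (by linarith [(sndHalf θ).2.1])).trans hbc⟩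
  -- the in-prong path reads the parameter `(1 - θ) c`, so `θ = 1 - val / c`
  set φ : I → I := fun θ ↦ ⟨1 - val θ / c, by
    have h1 := div_nonneg (hvalmem θ).1 hc0.le; have h2 := (div_le_one hc0).2 (hvalmem θ).2; constructor <;> linarith⟩ with hφ
  refine Path.Homotopic.of_reparam _ _ (φ := φ) (by rw [hφ]; fun_prop) ?_ ?_ fun θ ↦ ?_
  · apply Subtype.ext; show 1 - val 0 / c = 0; rw [hval, transFun_zero, βline_zero, div_self hc0.ne', sub_self]
  · apply Subtype.ext; show 1 - val 1 / c = 1; rw [hval, transFun_one]; simp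
  · rw [Path.trans_apply_eq_transFun, inP'_apply]
    show transFun (D.psegP hv0 j hc hb) (D.inP' hv0 j hb) θ = D.pos ((D.star v hv0).pt j ((1 - (1 - val θ / c)) * c, 0))
    rw [sub_sub_cancel, div_mul_cancel₀ _ hc0.ne', hval]
    unfold transFun
    split_ifs <;> rfl

end Prong

/-! ## The canonical middle arc and the canonical image of a piece -/

section Canon

variable {y : X} [NoncompactSpace (F.Leaf y)] {v v' : ℂ} (hv0 : D.nprong v ≠ 0) (hv0' : D.nprong v' ≠ 0)
  (Eb : (D.star v hv0).BwdTail hbi y) (Ef : (D.star v' hv0').FwdTail hbi y)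

/-- The point of the leaf over the parameter `b` of the backward tail. [folklore] -/
def tailPtB {b : ℝ} (hb : b ∈ Ioc 0 Eb.β₀) : F.Leaf y := Leaf.mk (ProngStar.lift hι ((D.star v hv0).pt Eb.j (b, 0))) (Eb.lift_mem_leaf hι hb)

/-- The point of the leaf over the parameter `b'` of the forward tail. [folklore] -/
def tailPtF {b' : ℝ} (hb' : b' ∈ Ioc 0 Ef.β₀) : F.Leaf y := Leaf.mk (ProngStar.lift hι ((D.star v' hv0').pt Ef.j (b', 0))) (Ef.lift_mem_leaf hι hb')

/-- The image of the backward tail point. [folklore] -/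
theorem ι_tailPtB {b : ℝ} (hb : b ∈ Ioc 0 Eb.β₀) : ι (Leaf.pt (D.tailPtB hι hv0 Eb hb)) = (D.star v hv0).pt Eb.j (b, 0) :=
  ProngStar.ι_lift hι ((D.star v hv0).diff_subset_range Eb.j ⟨(D.star v hv0).pt_mem
    ((ProngStar.mem_rect_iff _).2 ⟨⟨hb.1.le, hb.2.trans Eb.hβ₀.2⟩, by simp [(D.star v hv0).ρ_pos.le]⟩),
    (D.star v hv0).pt_ne ((ProngStar.mem_rect_iff _).2 ⟨⟨hb.1.le, hb.2.trans Eb.hβ₀.2⟩, by simp [(D.star v hv0).ρ_pos.le]⟩)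
      (fun h ↦ hb.1.ne' (congrArg Prod.fst h))⟩)

/-- The image of the forward tail point. [folklore] -/
theorem ι_tailPtF {b' : ℝ} (hb' : b' ∈ Ioc 0 Ef.β₀) : ι (Leaf.pt (D.tailPtF hι hv0' Ef hb')) = (D.star v' hv0').pt Ef.j (b', 0) :=
  ProngStar.ι_lift hι ((D.star v' hv0').diff_subset_range Ef.j ⟨(D.star v' hv0').pt_mem
    ((ProngStar.mem_rect_iff _).2 ⟨⟨hb'.1.le, hb'.2.trans Ef.hβ₀.2⟩, by simp [(D.star v' hv0').ρ_pos.le]⟩),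
    (D.star v' hv0').pt_ne ((ProngStar.mem_rect_iff _).2 ⟨⟨hb'.1.le, hb'.2.trans Ef.hβ₀.2⟩, by simp [(D.star v' hv0').ρ_pos.le]⟩)
      (fun h ↦ hb'.1.ne' (congrArg Prod.fst h))⟩)

/-- The backward tail point is in the backward tail. [folklore] -/
theorem tailPtB_mem_bwd {b : ℝ} (hb : b ∈ Ioc 0 Eb.β₀) : D.tailPtB hι hv0 Eb hb ∈ bwd hbi Eb.p :=
  (Eb.bwd_iff _).2 ⟨b, hb, D.ι_tailPtB hι hv0 Eb hb⟩

/-- The forward tail point is in the forward tail. [folklore] -/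
theorem tailPtF_mem_fwd {b' : ℝ} (hb' : b' ∈ Ioc 0 Ef.β₀) : D.tailPtF hι hv0' Ef hb' ∈ fwd hbi Ef.p :=
  (Ef.fwd_iff _).2 ⟨b', hb', D.ι_tailPtF hι hv0' Ef hb'⟩

/-- The parameter of the backward tail point. [folklore] -/
theorem b_tailPtB {b : ℝ} (hb : b ∈ Ioc 0 Eb.β₀) : (D.star v hv0).b Eb.j (ι (Leaf.pt (D.tailPtB hι hv0 Eb hb))) = b := by
  rw [D.ι_tailPtB hι hv0 Eb hb, ProngStar.b_pt]
  exact (ProngStar.mem_rect_iff _).2 ⟨⟨hb.1.le, hb.2.trans Eb.hβ₀.2⟩, by simp [(D.star v hv0).ρ_pos.le]⟩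

/-- The parameter of the forward tail point. [folklore] -/
theorem b_tailPtF {b' : ℝ} (hb' : b' ∈ Ioc 0 Ef.β₀) : (D.star v' hv0').b Ef.j (ι (Leaf.pt (D.tailPtF hι hv0' Ef hb'))) = b' := by
  rw [D.ι_tailPtF hι hv0' Ef hb', ProngStar.b_pt]
  exact (ProngStar.mem_rect_iff _).2 ⟨⟨hb'.1.le, hb'.2.trans Ef.hβ₀.2⟩, by simp [(D.star v' hv0').ρ_pos.le]⟩

/-- **Backward tail points are ordered by the parameter.** [folklore] -/
theorem not_lt_tailPtB (hα : v ∈ alphaSet hbi ι y) {b c : ℝ} (hb : b ∈ Ioc 0 Eb.β₀) (hc : c ∈ Ioc 0 Eb.β₀) (hbc : b ≤ c) :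
    ¬ leafLT hbi (D.tailPtB hι hv0 Eb hc) (D.tailPtB hι hv0 Eb hb) := fun h ↦ by
  have := (Eb.leafLT_iff_b_lt hι hα (D.tailPtB_mem_bwd hι hv0 Eb hb) (D.tailPtB_mem_bwd hι hv0 Eb hc)).1 h
  rw [D.b_tailPtB hι hv0 Eb hb, D.b_tailPtB hι hv0 Eb hc] at this
  exact absurd this (not_lt.2 hbc)

/-- **Forward tail points are ordered against the parameter.** [folklore] -/
theorem not_lt_tailPtF (hω : v' ∈ omegaSet hbi ι y) {b' c' : ℝ} (hb' : b' ∈ Ioc 0 Ef.β₀) (hc' : c' ∈ Ioc 0 Ef.β₀) (hbc : b' ≤ c') :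
    ¬ leafLT hbi (D.tailPtF hι hv0' Ef hb') (D.tailPtF hι hv0' Ef hc') := fun h ↦ by
  have := (Ef.leafLT_iff_b_lt hι hω (D.tailPtF_mem_fwd hι hv0' Ef hb') (D.tailPtF_mem_fwd hι hv0' Ef hc')).1 h
  rw [D.b_tailPtF hι hv0' Ef hb', D.b_tailPtF hι hv0' Ef hc'] at this
  exact absurd this (not_lt.2 hbc)

end Canon


/-! ## The canonical arc of a leaf interval and its image -/

section RefArc

variable {y : X} [NoncompactSpace (F.Leaf y)]

/-- **The canonical Jordan arc** of the closed leaf interval `[a, a']` (a chosen witness of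
`exists_leafIccPath`). [folklore] -/
def refArc (a a' : F.Leaf y) (h : leafLT hbi a a') : Path (Leaf.pt a) (Leaf.pt a') := (exists_leafIccPath h).choose

omit [Nonempty X] in
/-- The properties of the canonical arc. [folklore] -/
theorem refArc_spec (a a' : F.Leaf y) (h : leafLT hbi a a') :
    Continuous (toLeafSpace ∘ refArc a a' h : I → F.LeafSpace) ∧ Injective (refArc a a' h) ∧
      ∀ x, x ∈ range (refArc a a' h) ↔ ∃ r ∈ leafIcc hbi a a', Leaf.pt r = x :=
  (exists_leafIccPath h).choose_spec

/-- **The image of the canonical arc** in the leaf space of `T`. [folklore] -/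
def refP (a a' : F.Leaf y) (h : leafLT hbi a a') : Path (D.pos (ι (Leaf.pt a))) (D.pos (ι (Leaf.pt a'))) where
  toFun t := D.pos (ι (refArc a a' h t))
  continuous_toFun := D.foliated.continuous_leafMap.comp (refArc_spec a a' h).1
  source' := by simp only [(refArc a a' h).source]
  target' := by simp only [(refArc a a' h).target]

omit [Nonempty X] in
/-- The values of the image of the canonical arc. [folklore] -/
theorem refP_apply (a a' : F.Leaf y) (h : leafLT hbi a a') (t : I) : D.refP a a' h t = D.pos (ι (refArc a a' h t)) := rfl

end RefArc

/-! ## One cycle datum: the image of a piece is canonical -/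

section Core

variable {m : ℕ} [NeZero m] {C : Set ℂ} (hC : IsCompact C) {vtx : Fin m → ℂ} {sx : Fin m → X}
  [hnc : ∀ i, NoncompactSpace (F.Leaf (sx i))]
  (hv : ∀ i, vtx i ∈ D.P) (hmem : ∀ i, ∀ q : F.Leaf (sx i), ι (Leaf.pt q) ∈ C)
  (hω : ∀ i, omegaSet hbi ι (sx i) = {vtx i}) (hα : ∀ i, alphaSet hbi ι (sx (i + 1)) = {vtx i}) (i : Fin m)

/-- **The image of the piece `i`** as a path of the leaf space of `T` between its punctures.
[folklore] -/
def gPieceFin : Path (D.pos (vtx i)) (D.pos (vtx (i + 1))) where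
  toFun := toLeafSpace ∘ (g ∘ D.piece hι hC hv hmem hω hα i)
  continuous_toFun := D.continuous_toLeafSpace_g_piece hι hC hv hmem hω hα i
  source' := by simp only [comp_apply, piece_zero]; rfl
  target' := by simp only [comp_apply, piece_one]; rfl

/-- The values of the image of the piece. [folklore] -/
theorem gPieceFin_apply (θ : I) : D.gPieceFin hι hC hv hmem hω hα i θ = D.pos (D.piece hι hC hv hmem hω hα i θ) := rfl

/-- The parameter of the junction is in `[0, ρ]`. [folklore] -/
theorem β_mem_Icc : (D.jc hι hC hv hmem hω hα i).β ∈ Icc 0 (D.star (vtx i) (D.nprong_vtx_ne_zero hC hv hmem hω i (hbi := hbi))).ρ :=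
  ⟨(D.jc hι hC hv hmem hω hα i).hβin.1.le, (D.jc hι hC hv hmem hω hα i).hβin.2.trans (D.jc hι hC hv hmem hω hα i).Ef.hβ₀.2⟩

/-- **The image of the link** of the piece `i`, between the prong points. [folklore] -/
def linkP' : Path (D.pos ((D.star (vtx i) (D.nprong_vtx_ne_zero hC hv hmem hω i (hbi := hbi))).pt (D.jc hι hC hv hmem hω hα i).Eb.j
      ((D.jc hι hC hv hmem hω hα i).β, 0)))
    (D.pos ((D.star (vtx (i + 1)) (D.nprong_vtx_ne_zero hC hv hmem hω (i + 1) (hbi := hbi))).pt (D.jc hι hC hv hmem hω hα (i + 1)).Ef.j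
      ((D.jc hι hC hv hmem hω hα (i + 1)).β, 0))) where
  toFun := toLeafSpace ∘ (g ∘ D.linkArc hι hC hv hmem hω hα i)
  continuous_toFun := D.continuous_toLeafSpace_g_linkArc hι hC hv hmem hω hα i
  source' := by
    show D.pos (ι (D.cycℓ hι hC hv hmem hω hα i 0)) = _
    rw [(D.cycℓ hι hC hv hmem hω hα i).source]
    exact congrArg D.pos (D.jc hι hC hv hmem hω hα i).Kout.ι_base
  target' := by
    show D.pos (ι (D.cycℓ hι hC hv hmem hω hα i 1)) = _
    rw [(D.cycℓ hι hC hv hmem hω hα i).target]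
    exact congrArg D.pos (D.jc hι hC hv hmem hω hα (i + 1)).Kin.ι_base

/-- **The image of a piece is out-prong, link, in-prong**, as paths. [folklore] -/
theorem gPieceFin_eq :
    D.gPieceFin hι hC hv hmem hω hα i =
      ((D.outP' (D.nprong_vtx_ne_zero hC hv hmem hω i (hbi := hbi)) (D.jc hι hC hv hmem hω hα i).Eb.j (D.β_mem_Icc hι hC hv hmem hω hα i)).trans
        (D.linkP' hι hC hv hmem hω hα i)).trans
      (D.inP' (D.nprong_vtx_ne_zero hC hv hmem hω (i + 1) (hbi := hbi)) (D.jc hι hC hv hmem hω hα (i + 1)).Ef.j (D.β_mem_Icc hι hC hv hmem hω hα (i + 1))) := by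
  apply Path.eq_of_forall_eq
  intro θ
  rw [gPieceFin_apply, Path.trans_apply_eq_transFun, piece, ← transFun_map D.pos]
  refine transFun_congr (fun θ' ↦ ?_) (fun θ' ↦ rfl) θ
  rw [Path.trans_apply_eq_transFun, ← transFun_map D.pos]
  exact transFun_congr (fun _ ↦ rfl) (fun _ ↦ rfl) θ'

variable {b b' : ℝ} (hb : b ∈ Ioc 0 (D.jc hι hC hv hmem hω hα i).β) (hb' : b' ∈ Ioc 0 (D.jc hι hC hv hmem hω hα (i + 1)).β)

include hb in
/-- The parameter `b` is in `(0, β₀]` of the backward tail. [folklore] -/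
theorem b_mem_tail : b ∈ Ioc 0 (D.jc hι hC hv hmem hω hα i).Eb.β₀ := ⟨hb.1, hb.2.trans (D.jc hι hC hv hmem hω hα i).hβout.2⟩

include hb' in
/-- The parameter `b'` is in `(0, β₀]` of the forward tail. [folklore] -/
theorem b'_mem_tail : b' ∈ Ioc 0 (D.jc hι hC hv hmem hω hα (i + 1)).Ef.β₀ := ⟨hb'.1, hb'.2.trans (D.jc hι hC hv hmem hω hα (i + 1)).hβin.2⟩

include hb in
/-- The parameter `b` is in `[0, ρ]`. [folklore] -/
theorem b_mem_Icc : b ∈ Icc 0 (D.star (vtx i) (D.nprong_vtx_ne_zero hC hv hmem hω i (hbi := hbi))).ρ :=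
  ⟨hb.1.le, (D.b_mem_tail hι hC hv hmem hω hα i hb).2.trans (D.jc hι hC hv hmem hω hα i).Eb.hβ₀.2⟩

include hb' in
/-- The parameter `b'` is in `[0, ρ]`. [folklore] -/
theorem b'_mem_Icc : b' ∈ Icc 0 (D.star (vtx (i + 1)) (D.nprong_vtx_ne_zero hC hv hmem hω (i + 1) (hbi := hbi))).ρ :=
  ⟨hb'.1.le, (D.b'_mem_tail hι hC hv hmem hω hα i hb').2.trans (D.jc hι hC hv hmem hω hα (i + 1)).Ef.hβ₀.2⟩

/-- The point of the leaf of `sx (i + 1)` over the parameter `b` of the outgoing prong. [folklore] -/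
def aPt : F.Leaf (sx (i + 1)) := D.tailPtB hι _ (D.jc hι hC hv hmem hω hα i).Eb (D.b_mem_tail hι hC hv hmem hω hα i hb)

/-- The point of the leaf of `sx (i + 1)` over the parameter `b'` of the incoming prong. [folklore] -/
def aPt' : F.Leaf (sx (i + 1)) := D.tailPtF hι _ (D.jc hι hC hv hmem hω hα (i + 1)).Ef (D.b'_mem_tail hι hC hv hmem hω hα i hb')

/-- The start of the link is the point over `β`. [folklore] -/
theorem linkStart_eq : D.linkStart hι hC hv hmem hω hα i =
    D.aPt hι hC hv hmem hω hα i (b := (D.jc hι hC hv hmem hω hα i).β) ⟨(D.jc hι hC hv hmem hω hα i).hβout.1, le_rfl⟩ := by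
  apply Leaf.injective_coe F (sx (i + 1))
  show Leaf.pt (D.linkStart hι hC hv hmem hω hα i) = ProngStar.lift hι _
  rw [D.pt_linkStart hι hC hv hmem hω hα i]
  rfl

/-- The end of the link is the point over `β'`. [folklore] -/
theorem linkEnd_eq : D.linkEnd hι hC hv hmem hω hα i =
    D.aPt' hι hC hv hmem hω hα i (b' := (D.jc hι hC hv hmem hω hα (i + 1)).β) ⟨(D.jc hι hC hv hmem hω hα (i + 1)).hβin.1, le_rfl⟩ := by
  apply Leaf.injective_coe F (sx (i + 1))
  show Leaf.pt (D.linkEnd hι hC hv hmem hω hα i) = ProngStar.lift hι _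
  rw [D.pt_linkEnd hι hC hv hmem hω hα i]
  rfl

include hb hb' in
/-- **The point over `b` is strictly before the point over `b'`** (the link runs forward in
between). [folklore] -/
theorem aPt_lt_aPt' : leafLT hbi (D.aPt hι hC hv hmem hω hα i hb) (D.aPt' hι hC hv hmem hω hα i hb') := by
  have hαi : vtx i ∈ alphaSet hbi ι (sx (i + 1)) := by rw [hα i]; exact mem_singleton _
  have hωi : vtx (i + 1) ∈ omegaSet hbi ι (sx (i + 1)) := by rw [hω (i + 1)]; exact mem_singleton _
  have h1 : ¬ leafLT hbi (D.linkStart hι hC hv hmem hω hα i) (D.aPt hι hC hv hmem hω hα i hb) := by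
    rw [D.linkStart_eq hι hC hv hmem hω hα i]
    exact D.not_lt_tailPtB hι _ _ hαi _ _ hb.2
  have h2 : ¬ leafLT hbi (D.aPt' hι hC hv hmem hω hα i hb') (D.linkEnd hι hC hv hmem hω hα i) := by
    rw [D.linkEnd_eq hι hC hv hmem hω hα i]
    exact D.not_lt_tailPtF hι _ _ hωi _ _ hb'.2
  have h12 := D.linkStart_lt_linkEnd hι hC hv hmem hω hα i
  have h3 : leafLT hbi (D.aPt hι hC hv hmem hω hα i hb) (D.linkEnd hι hC hv hmem hω hα i) := by
    rcases not_leafLT_iff.1 h1 with h | h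
    · exact leafLT_trans h h12
    · rw [h]; exact h12
  rcases not_leafLT_iff.1 h2 with h | h
  · exact leafLT_trans h3 h
  · rw [← h]; exact h3

/-- **The middle of the piece**: the prong segment from `b` to `β`, the link, the prong segment
from `β'` to `b'`, in the leaf space. [folklore] -/
def midP : Path (D.pos ((D.star (vtx i) (D.nprong_vtx_ne_zero hC hv hmem hω i (hbi := hbi))).pt (D.jc hι hC hv hmem hω hα i).Eb.j (b, 0)))
    (D.pos ((D.star (vtx (i + 1)) (D.nprong_vtx_ne_zero hC hv hmem hω (i + 1) (hbi := hbi))).pt (D.jc hι hC hv hmem hω hα (i + 1)).Ef.j (b', 0))) :=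
  ((D.psegP _ _ (D.b_mem_Icc hι hC hv hmem hω hα i hb) (D.β_mem_Icc hι hC hv hmem hω hα i)).trans (D.linkP' hι hC hv hmem hω hα i)).trans
    (D.psegP _ _ (D.β_mem_Icc hι hC hv hmem hω hα (i + 1)) (D.b'_mem_Icc hι hC hv hmem hω hα i hb'))

/-- The prong segment of the outgoing prong, in `X`. [folklore] -/
def segX : Path (Leaf.pt (D.aPt hι hC hv hmem hω hα i hb)) (D.cycJ hι hC hv hmem hω hα i).Kout.base where
  toFun θ := ProngStar.lift hι ((D.star (vtx i) (D.nprong_vtx_ne_zero hC hv hmem hω i (hbi := hbi))).pt (D.jc hι hC hv hmem hω hα i).Eb.j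
    (βline b (D.jc hι hC hv hmem hω hα i).β θ, 0))
  continuous_toFun := WalkJunction.continuous_lift_pt (hι := hι) _ _ (by unfold βline; fun_prop)
    (fun θ ↦ (ProngStar.mem_rect_iff _).2 ⟨βline_mem (D.b_mem_Icc hι hC hv hmem hω hα i hb) (D.β_mem_Icc hι hC hv hmem hω hα i) θ,
      by simp [(D.star (vtx i) _).ρ_pos.le]⟩)
    (fun θ h ↦ by
      have h1 := congrArg Prod.fst h
      have h2 : b ≤ βline b (D.jc hι hC hv hmem hω hα i).β θ := by
        unfold βline; nlinarith [θ.2.1, θ.2.2, hb.2]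
      simp only [Prod.fst_zero] at h1; linarith [hb.1])
  source' := by simp only [βline_zero]; rfl
  target' := by simp only [βline_one]; rfl

/-- The prong segment of the incoming prong, in `X`. [folklore] -/
def segX' : Path (D.cycJ hι hC hv hmem hω hα (i + 1)).Kin.base (Leaf.pt (D.aPt' hι hC hv hmem hω hα i hb')) where
  toFun θ := ProngStar.lift hι ((D.star (vtx (i + 1)) (D.nprong_vtx_ne_zero hC hv hmem hω (i + 1) (hbi := hbi))).pt (D.jc hι hC hv hmem hω hα (i + 1)).Ef.j
    (βline (D.jc hι hC hv hmem hω hα (i + 1)).β b' θ, 0))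
  continuous_toFun := WalkJunction.continuous_lift_pt (hι := hι) _ _ (by unfold βline; fun_prop)
    (fun θ ↦ (ProngStar.mem_rect_iff _).2 ⟨βline_mem (D.β_mem_Icc hι hC hv hmem hω hα (i + 1)) (D.b'_mem_Icc hι hC hv hmem hω hα i hb') θ,
      by simp [(D.star (vtx (i + 1)) _).ρ_pos.le]⟩)
    (fun θ h ↦ by
      have h1 := congrArg Prod.fst h
      have h2 : b' ≤ βline (D.jc hι hC hv hmem hω hα (i + 1)).β b' θ := by
        unfold βline; nlinarith [θ.2.1, θ.2.2, hb'.2]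
      simp only [Prod.fst_zero] at h1; linarith [hb'.1])
  source' := by simp only [βline_zero]; rfl
  target' := by simp only [βline_one]; rfl

/-- The middle of the piece, in `X`. [folklore] -/
def midX : Path (Leaf.pt (D.aPt hι hC hv hmem hω hα i hb)) (Leaf.pt (D.aPt' hι hC hv hmem hω hα i hb')) :=
  ((D.segX hι hC hv hmem hω hα i hb).trans (D.cycℓ hι hC hv hmem hω hα i)).trans (D.segX' hι hC hv hmem hω hα i hb')

/-- **The middle of the piece is `pos ∘ ι` of its planar version.** [folklore] -/
theorem midP_apply (θ : I) : D.midP hι hC hv hmem hω hα i hb hb' θ = D.pos (ι (D.midX hι hC hv hmem hω hα i hb hb' θ)) := by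
  have hr : ∀ {w : ℂ} {k : ℕ} (P : ProngStar F ι w k) (j : ZMod k) {c : ℝ}, c ∈ Icc 0 P.ρ → 0 < c →
      D.pos (P.pt j (c, 0)) = D.pos (ι (ProngStar.lift hι (P.pt j (c, 0)))) := by
    intro w k P j c hc hc0
    have hrect : ((c, 0) : ℝ × ℝ) ∈ P.rect := (P.mem_rect_iff).2 ⟨hc, by simp [P.ρ_pos.le]⟩
    rw [ProngStar.ι_lift hι (P.diff_subset_range j ⟨P.pt_mem hrect, P.pt_ne hrect fun h ↦ hc0.ne' (congrArg Prod.fst h)⟩)]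
  rw [midP, midX, Path.trans_apply_eq_transFun, Path.trans_apply_eq_transFun, ← transFun_map (fun x ↦ D.pos (ι x))]
  refine transFun_congr (fun θ' ↦ ?_) (fun θ' ↦ ?_) θ
  · rw [Path.trans_apply_eq_transFun, Path.trans_apply_eq_transFun, ← transFun_map (fun x ↦ D.pos (ι x))]
    refine transFun_congr (fun θ'' ↦ ?_) (fun θ'' ↦ rfl) θ'
    rw [psegP_apply]
    exact hr _ _ (βline_mem (D.b_mem_Icc hι hC hv hmem hω hα i hb) (D.β_mem_Icc hι hC hv hmem hω hα i) θ'')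
      (by have : b ≤ βline b (D.jc hι hC hv hmem hω hα i).β θ'' := by unfold βline; nlinarith [θ''.2.1, θ''.2.2, hb.2]
          linarith [hb.1])
  · rw [psegP_apply]
    exact hr _ _ (βline_mem (D.β_mem_Icc hι hC hv hmem hω hα (i + 1)) (D.b'_mem_Icc hι hC hv hmem hω hα i hb') θ')
      (by have : b' ≤ βline (D.jc hι hC hv hmem hω hα (i + 1)).β b' θ' := by unfold βline; nlinarith [θ'.2.1, θ'.2.2, hb'.2]
          linarith [hb'.1])

include hb hb' in
/-- **The planar middle of the piece lies in the closed leaf interval between the points over `b`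
and `b'`.** [folklore] -/
theorem range_midX_subset : range (D.midX hι hC hv hmem hω hα i hb hb') ⊆
    {x | ∃ r ∈ leafIcc hbi (D.aPt hι hC hv hmem hω hα i hb) (D.aPt' hι hC hv hmem hω hα i hb'), Leaf.pt r = x} := by
  have hαi : vtx i ∈ alphaSet hbi ι (sx (i + 1)) := by rw [hα i]; exact mem_singleton _
  have hωi : vtx (i + 1) ∈ omegaSet hbi ι (sx (i + 1)) := by rw [hω (i + 1)]; exact mem_singleton _
  set E := D.jc hι hC hv hmem hω hα i with hE
  set E' := D.jc hι hC hv hmem hω hα (i + 1) with hE'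
  have hlt := D.aPt_lt_aPt' hι hC hv hmem hω hα i hb hb'
  -- order facts: `a_b ≤ linkStart < linkEnd ≤ a'_b'`
  have hls : ¬ leafLT hbi (D.linkStart hι hC hv hmem hω hα i) (D.aPt hι hC hv hmem hω hα i hb) := by
    rw [D.linkStart_eq hι hC hv hmem hω hα i]; exact D.not_lt_tailPtB hι _ _ hαi _ _ hb.2
  have hle : ¬ leafLT hbi (D.aPt' hι hC hv hmem hω hα i hb') (D.linkEnd hι hC hv hmem hω hα i) := by
    rw [D.linkEnd_eq hι hC hv hmem hω hα i]; exact D.not_lt_tailPtF hι _ _ hωi _ _ hb'.2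
  -- the three ranges
  rw [midX, Path.trans_range, Path.trans_range]
  rintro x ((⟨θ, rfl⟩ | hx) | ⟨θ, rfl⟩)
  · -- the outgoing prong segment: the point over `c = βline b β θ ∈ [b, β]`
    have hc : βline b E.β θ ∈ Ioc 0 E.Eb.β₀ := by
      have := βline_mem (ρ := E.β) ⟨hb.1.le, hb.2⟩ ⟨E.hβout.1.le, le_rfl⟩ θ
      refine ⟨?_, this.2.trans E.hβout.2⟩
      have : b ≤ βline b E.β θ := by unfold βline; nlinarith [θ.2.1, θ.2.2, hb.2]
      linarith [hb.1]
    refine ⟨D.tailPtB hι _ E.Eb hc, ⟨?_, ?_⟩, rfl⟩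
    · exact D.not_lt_tailPtB hι _ _ hαi _ _ (by show b ≤ βline b E.β θ; unfold βline; nlinarith [θ.2.1, θ.2.2, hb.2])
    · -- `q ≤ linkStart < a'`
      have hq : ¬ leafLT hbi (D.linkStart hι hC hv hmem hω hα i) (D.tailPtB hι _ E.Eb hc) := by
        rw [D.linkStart_eq hι hC hv hmem hω hα i]
        exact D.not_lt_tailPtB hι _ _ hαi _ _ (βline_mem (ρ := E.β) ⟨hb.1.le, hb.2⟩ ⟨E.hβout.1.le, le_rfl⟩ θ).2
      intro h
      have h12 := D.linkStart_lt_linkEnd hι hC hv hmem hω hα i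
      have h3 : leafLT hbi (D.linkStart hι hC hv hmem hω hα i) (D.aPt' hι hC hv hmem hω hα i hb') := by
        rcases not_leafLT_iff.1 hle with h' | h'
        · exact leafLT_trans h12 h'
        · rw [← h']; exact h12
      rcases not_leafLT_iff.1 hq with h' | h'
      · exact leafLT_asymm (leafLT_trans h h') h3
      · rw [h'] at h; exact leafLT_asymm h h3
  · -- the link
    obtain ⟨r, hr, hrx⟩ := (D.mem_range_cycℓ_iff hι hC hv hmem hω hα i).1 hx
    refine ⟨r, ⟨fun h ↦ ?_, fun h ↦ ?_⟩, hrx⟩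
    · rcases not_leafLT_iff.1 hls with h' | h'
      · exact hr.1 (leafLT_trans h h')
      · rw [h'] at h; exact hr.1 h
    · rcases not_leafLT_iff.1 hle with h' | h'
      · exact hr.2 (leafLT_trans h' h)
      · rw [← h'] at h; exact hr.2 h
  · -- the incoming prong segment: the point over `c' = βline β' b' θ ∈ [b', β']`
    have hc : βline E'.β b' θ ∈ Ioc 0 E'.Ef.β₀ := by
      have := βline_mem (ρ := E'.β) ⟨E'.hβin.1.le, le_rfl⟩ ⟨hb'.1.le, hb'.2⟩ θ
      refine ⟨?_, this.2.trans E'.hβin.2⟩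
      have : b' ≤ βline E'.β b' θ := by unfold βline; nlinarith [θ.2.1, θ.2.2, hb'.2]
      linarith [hb'.1]
    refine ⟨D.tailPtF hι _ E'.Ef hc, ⟨?_, ?_⟩, rfl⟩
    · -- `a < linkEnd ≤ q`
      have hq : ¬ leafLT hbi (D.tailPtF hι _ E'.Ef hc) (D.linkEnd hι hC hv hmem hω hα i) := by
        rw [D.linkEnd_eq hι hC hv hmem hω hα i]
        exact D.not_lt_tailPtF hι _ _ hωi _ _ (βline_mem (ρ := E'.β) ⟨E'.hβin.1.le, le_rfl⟩ ⟨hb'.1.le, hb'.2⟩ θ).2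
      intro h
      have h12 := D.linkStart_lt_linkEnd hι hC hv hmem hω hα i
      have h3 : leafLT hbi (D.aPt hι hC hv hmem hω hα i hb) (D.linkEnd hι hC hv hmem hω hα i) := by
        rcases not_leafLT_iff.1 hls with h' | h'
        · exact leafLT_trans h' h12
        · rw [h']; exact h12
      rcases not_leafLT_iff.1 hq with h' | h'
      · exact leafLT_asymm (leafLT_trans h' h) h3
      · rw [h'] at h3; exact leafLT_asymm h h3
    · exact D.not_lt_tailPtF hι _ _ hωi _ _ (by show b' ≤ βline E'.β b' θ; unfold βline; nlinarith [θ.2.1, θ.2.2, hb'.2])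

include hb hb' in
/-- **The middle of the piece is homotopic to the image of the canonical arc** between the points
over `b` and `b'`. [folklore] -/
theorem midP_homotopic_refP :
    (D.midP hι hC hv hmem hω hα i hb hb').Homotopic
      (((D.refP (D.aPt hι hC hv hmem hω hα i hb) (D.aPt' hι hC hv hmem hω hα i hb') (D.aPt_lt_aPt' hι hC hv hmem hω hα i hb hb')).cast
        (congrArg D.pos (D.ι_tailPtB hι _ _ (D.b_mem_tail hι hC hv hmem hω hα i hb)).symm)
        (congrArg D.pos (D.ι_tailPtF hι _ _ (D.b'_mem_tail hι hC hv hmem hω hα i hb')).symm))) := by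
  set a := D.aPt hι hC hv hmem hω hα i hb with ha
  set a' := D.aPt' hι hC hv hmem hω hα i hb' with ha'
  have hlt := D.aPt_lt_aPt' hι hC hv hmem hω hα i hb hb'
  obtain ⟨-, hinj, hrange⟩ := refArc_spec a a' hlt
  have hsub : range (D.midX hι hC hv hmem hω hα i hb hb') ⊆ range (refArc a a' hlt) := fun x hx ↦
    (hrange x).2 (D.range_midX_subset hι hC hv hmem hω hα i hb hb' hx)
  obtain ⟨φ, hφc, hφ0, hφ1, hφ⟩ := exists_reparam_of_range_subset (refArc a a' hlt) (D.midX hι hC hv hmem hω hα i hb hb') hinj hsub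
  refine (Path.Homotopic.of_reparam _ _ hφc hφ0 hφ1 fun t ↦ ?_).symm
  rw [midP_apply, hφ t]
  rfl

include hb hb' in
/-- **The image of a piece is canonical**: out-prong to `b`, the image of the canonical arc from
the point over `b` to the point over `b'`, in-prong from `b'`. [folklore] -/
theorem gPieceFin_homotopic_canon :
    (D.gPieceFin hι hC hv hmem hω hα i).Homotopic
      (((D.outP' (D.nprong_vtx_ne_zero hC hv hmem hω i (hbi := hbi)) (D.jc hι hC hv hmem hω hα i).Eb.j (D.b_mem_Icc hι hC hv hmem hω hα i hb)).trans
        ((D.refP (D.aPt hι hC hv hmem hω hα i hb) (D.aPt' hι hC hv hmem hω hα i hb') (D.aPt_lt_aPt' hι hC hv hmem hω hα i hb hb')).cast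
          (congrArg D.pos (D.ι_tailPtB hι _ _ (D.b_mem_tail hι hC hv hmem hω hα i hb)).symm)
          (congrArg D.pos (D.ι_tailPtF hι _ _ (D.b'_mem_tail hι hC hv hmem hω hα i hb')).symm))).trans
      (D.inP' (D.nprong_vtx_ne_zero hC hv hmem hω (i + 1) (hbi := hbi)) (D.jc hι hC hv hmem hω hα (i + 1)).Ef.j (D.b'_mem_Icc hι hC hv hmem hω hα i hb'))) := by
  set hvi := D.nprong_vtx_ne_zero hC hv hmem hω i (hbi := hbi)
  set hvi' := D.nprong_vtx_ne_zero hC hv hmem hω (i + 1) (hbi := hbi)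
  set E := D.jc hι hC hv hmem hω hα i with hE
  set E' := D.jc hι hC hv hmem hω hα (i + 1) with hE'
  set O := D.outP' hvi E.Eb.j (D.b_mem_Icc hι hC hv hmem hω hα i hb) with hO
  set S := D.psegP hvi E.Eb.j (D.b_mem_Icc hι hC hv hmem hω hα i hb) (D.β_mem_Icc hι hC hv hmem hω hα i) with hS
  set L := D.linkP' hι hC hv hmem hω hα i with hL
  set S' := D.psegP hvi' E'.Ef.j (D.β_mem_Icc hι hC hv hmem hω hα (i + 1)) (D.b'_mem_Icc hι hC hv hmem hω hα i hb') with hS'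
  set In := D.inP' hvi' E'.Ef.j (D.b'_mem_Icc hι hC hv hmem hω hα i hb') with hIn
  -- slide along the prongs
  have h1 := D.outP'_homotopic hvi E.Eb.j (D.b_mem_Icc hι hC hv hmem hω hα i hb) (D.β_mem_Icc hι hC hv hmem hω hα i) hb.2 E.hβout.1
  have h2 := D.inP'_homotopic hvi' E'.Ef.j (D.b'_mem_Icc hι hC hv hmem hω hα i hb') (D.β_mem_Icc hι hC hv hmem hω hα (i + 1)) hb'.2 E'.hβin.1
  rw [D.gPieceFin_eq hι hC hv hmem hω hα i]
  refine ((h1.hcomp (Path.Homotopic.refl L)).hcomp h2).trans ?_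
  -- `((O·S)·L)·(S'·In) ≃ (O·((S·L)·S'))·In`
  have h3 : (((O.trans S).trans L).trans (S'.trans In)).Homotopic ((((O.trans S).trans L).trans S').trans In) := (Path.Homotopic.assoc _ _ _).symm
  have h4 : ((((O.trans S).trans L).trans S').trans In).Homotopic ((O.trans ((S.trans L).trans S')).trans In) :=
    (((Path.Homotopic.assoc _ _ _).hcomp (Path.Homotopic.refl S')).trans (Path.Homotopic.assoc _ _ _)).hcomp (Path.Homotopic.refl In)
  refine (h3.trans h4).trans ?_
  exact ((Path.Homotopic.refl O).hcomp (D.midP_homotopic_refP hι hC hv hmem hω hα i hb hb')).hcomp (Path.Homotopic.refl In)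

end Core


/-! ## The canonical form as a function of plain data; two cycle data -/

section Canon2

/-- **The canonical image of a piece**, as a function of plain data: the saddles and prongs, the
separatrix point with the two tail points `a < a'` of its leaf, the parameters. [folklore] -/
def canonP {v : ℂ} (hv0 : D.nprong v ≠ 0) (jo : ZMod (D.nprong v)) {v' : ℂ} (hv0' : D.nprong v' ≠ 0) (ji : ZMod (D.nprong v'))
    {y : X} [NoncompactSpace (F.Leaf y)] (a a' : F.Leaf y) (hlt : leafLT hbi a a') {b b' : ℝ}
    (hbI : b ∈ Icc 0 (D.star v hv0).ρ) (hb'I : b' ∈ Icc 0 (D.star v' hv0').ρ)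
    (ha : ι (Leaf.pt a) = (D.star v hv0).pt jo (b, 0)) (ha' : ι (Leaf.pt a') = (D.star v' hv0').pt ji (b', 0)) : Path (D.pos v) (D.pos v') :=
  ((D.outP' hv0 jo hbI).trans ((D.refP a a' hlt).cast (congrArg D.pos ha).symm (congrArg D.pos ha').symm)).trans (D.inP' hv0' ji hb'I)

omit [Nonempty X] in
include hι in
/-- **The canonical image of a piece does not depend on the presentation of the data.** [folklore] -/
theorem canonP_congr {v₁ v₂ : ℂ} (hvv : v₂ = v₁) {hv0₁ : D.nprong v₁ ≠ 0} {hv0₂ : D.nprong v₂ ≠ 0}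
    {jo₁ : ZMod (D.nprong v₁)} {jo₂ : ZMod (D.nprong v₂)} (hjo : HEq jo₂ jo₁)
    {v'₁ v'₂ : ℂ} (hvv' : v'₂ = v'₁) {hv0'₁ : D.nprong v'₁ ≠ 0} {hv0'₂ : D.nprong v'₂ ≠ 0}
    {ji₁ : ZMod (D.nprong v'₁)} {ji₂ : ZMod (D.nprong v'₂)} (hji : HEq ji₂ ji₁)
    {y₁ y₂ : X} [NoncompactSpace (F.Leaf y₁)] [NoncompactSpace (F.Leaf y₂)] (hyy : y₂ = y₁)
    {a₁ a'₁ : F.Leaf y₁} {a₂ a'₂ : F.Leaf y₂} (hlt₁ : leafLT hbi a₁ a'₁) (hlt₂ : leafLT hbi a₂ a'₂) {b b' : ℝ}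
    (hbI₁ : b ∈ Icc 0 (D.star v₁ hv0₁).ρ) (hbI₂ : b ∈ Icc 0 (D.star v₂ hv0₂).ρ)
    (hb'I₁ : b' ∈ Icc 0 (D.star v'₁ hv0'₁).ρ) (hb'I₂ : b' ∈ Icc 0 (D.star v'₂ hv0'₂).ρ)
    (ha₁ : ι (Leaf.pt a₁) = (D.star v₁ hv0₁).pt jo₁ (b, 0)) (ha'₁ : ι (Leaf.pt a'₁) = (D.star v'₁ hv0'₁).pt ji₁ (b', 0))
    (ha₂ : ι (Leaf.pt a₂) = (D.star v₂ hv0₂).pt jo₂ (b, 0)) (ha'₂ : ι (Leaf.pt a'₂) = (D.star v'₂ hv0'₂).pt ji₂ (b', 0)) :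
    D.canonP hv0₂ jo₂ hv0'₂ ji₂ a₂ a'₂ hlt₂ hbI₂ hb'I₂ ha₂ ha'₂ =
      (D.canonP hv0₁ jo₁ hv0'₁ ji₁ a₁ a'₁ hlt₁ hbI₁ hb'I₁ ha₁ ha'₁).cast (congrArg D.pos hvv) (congrArg D.pos hvv') := by
  subst hvv hvv' hyy
  have hjo' : jo₂ = jo₁ := eq_of_heq hjo
  have hji' : ji₂ = ji₁ := eq_of_heq hji
  subst hjo' hji'
  have haa : a₂ = a₁ := Leaf.injective_coe F _ (hι.injective (ha₂.trans ha₁.symm))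
  have haa' : a'₂ = a'₁ := Leaf.injective_coe F _ (hι.injective (ha'₂.trans ha'₁.symm))
  subst haa haa'
  rfl

omit [Nonempty X] in
/-- **The prong of two backward tails of one leaf point, read through equal presentations, is the
same.** [folklore] -/
theorem bwdTail_j_heq {v₁ v₂ : ℂ} (hvv : v₂ = v₁) {hv0₁ : D.nprong v₁ ≠ 0} {hv0₂ : D.nprong v₂ ≠ 0}
    {y₁ y₂ : X} [NoncompactSpace (F.Leaf y₁)] [NoncompactSpace (F.Leaf y₂)] (hyy : y₂ = y₁)
    (E₁ : (D.star v₁ hv0₁).BwdTail hbi y₁) (E₂ : (D.star v₂ hv0₂).BwdTail hbi y₂) : HEq E₂.j E₁.j := by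
  subst hvv hyy
  exact heq_of_eq (ProngStar.BwdTail.j_eq E₂ E₁)

omit [Nonempty X] in
/-- **The prong of two forward tails of one leaf point, read through equal presentations, is the
same.** [folklore] -/
theorem fwdTail_j_heq {v₁ v₂ : ℂ} (hvv : v₂ = v₁) {hv0₁ : D.nprong v₁ ≠ 0} {hv0₂ : D.nprong v₂ ≠ 0}
    {y₁ y₂ : X} [NoncompactSpace (F.Leaf y₁)] [NoncompactSpace (F.Leaf y₂)] (hyy : y₂ = y₁)
    (E₁ : (D.star v₁ hv0₁).FwdTail hbi y₁) (E₂ : (D.star v₂ hv0₂).FwdTail hbi y₂) : HEq E₂.j E₁.j := by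
  subst hvv hyy
  exact heq_of_eq (ProngStar.FwdTail.j_eq E₂ E₁)

variable {m : ℕ} [NeZero m] {C : Set ℂ} (hC : IsCompact C) {vtx : Fin m → ℂ} {sx : Fin m → X}
  [hnc : ∀ i, NoncompactSpace (F.Leaf (sx i))]
  (hv : ∀ i, vtx i ∈ D.P) (hmem : ∀ i, ∀ q : F.Leaf (sx i), ι (Leaf.pt q) ∈ C)
  (hω : ∀ i, omegaSet hbi ι (sx i) = {vtx i}) (hα : ∀ i, alphaSet hbi ι (sx (i + 1)) = {vtx i})
variable {m₂ : ℕ} [NeZero m₂] {C₂ : Set ℂ} (hC₂ : IsCompact C₂) {vtx₂ : Fin m₂ → ℂ} {sx₂ : Fin m₂ → X}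
  [hnc₂ : ∀ i, NoncompactSpace (F.Leaf (sx₂ i))]
  (hv₂ : ∀ i, vtx₂ i ∈ D.P) (hmem₂ : ∀ i, ∀ q : F.Leaf (sx₂ i), ι (Leaf.pt q) ∈ C₂)
  (hω₂ : ∀ i, omegaSet hbi ι (sx₂ i) = {vtx₂ i}) (hα₂ : ∀ i, alphaSet hbi ι (sx₂ (i + 1)) = {vtx₂ i})

/-- The image of a piece, in canonical form. [folklore] -/
theorem gPieceFin_homotopic_canonP (i : Fin m) {b b' : ℝ} (hb : b ∈ Ioc 0 (D.jc hι hC hv hmem hω hα i).β)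
    (hb' : b' ∈ Ioc 0 (D.jc hι hC hv hmem hω hα (i + 1)).β) :
    (D.gPieceFin hι hC hv hmem hω hα i).Homotopic
      (D.canonP (D.nprong_vtx_ne_zero hC hv hmem hω i (hbi := hbi)) (D.jc hι hC hv hmem hω hα i).Eb.j
        (D.nprong_vtx_ne_zero hC hv hmem hω (i + 1) (hbi := hbi)) (D.jc hι hC hv hmem hω hα (i + 1)).Ef.j
        (D.aPt hι hC hv hmem hω hα i hb) (D.aPt' hι hC hv hmem hω hα i hb') (D.aPt_lt_aPt' hι hC hv hmem hω hα i hb hb')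
        (D.b_mem_Icc hι hC hv hmem hω hα i hb) (D.b'_mem_Icc hι hC hv hmem hω hα i hb')
        (D.ι_tailPtB hι _ _ (D.b_mem_tail hι hC hv hmem hω hα i hb)) (D.ι_tailPtF hι _ _ (D.b'_mem_tail hι hC hv hmem hω hα i hb'))) :=
  D.gPieceFin_homotopic_canon hι hC hv hmem hω hα i hb hb'

/-- **The images of the pieces of two cycle data along the same separatrix between the same saddles
are homotopic.** [folklore] -/
theorem gPieceFin_homotopic (i : Fin m) (i₂ : Fin m₂) (hvv : vtx₂ i₂ = vtx i) (hvv' : vtx₂ (i₂ + 1) = vtx (i + 1))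
    (hyy : sx₂ (i₂ + 1) = sx (i + 1)) :
    (D.gPieceFin hι hC₂ hv₂ hmem₂ hω₂ hα₂ i₂).Homotopic ((D.gPieceFin hι hC hv hmem hω hα i).cast (congrArg D.pos hvv) (congrArg D.pos hvv')) := by
  set E := D.jc hι hC hv hmem hω hα i with hE
  set E' := D.jc hι hC hv hmem hω hα (i + 1) with hE'
  set E₂ := D.jc hι hC₂ hv₂ hmem₂ hω₂ hα₂ i₂ with hE₂
  set E'₂ := D.jc hι hC₂ hv₂ hmem₂ hω₂ hα₂ (i₂ + 1) with hE'₂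
  -- common small parameters
  set b := min E.β E₂.β with hb
  set b' := min E'.β E'₂.β with hb'
  have hb₁ : b ∈ Ioc 0 E.β := ⟨lt_min E.hβin.1 E₂.hβin.1, min_le_left _ _⟩
  have hb₂ : b ∈ Ioc 0 E₂.β := ⟨lt_min E.hβin.1 E₂.hβin.1, min_le_right _ _⟩
  have hb'₁ : b' ∈ Ioc 0 E'.β := ⟨lt_min E'.hβin.1 E'₂.hβin.1, min_le_left _ _⟩
  have hb'₂ : b' ∈ Ioc 0 E'₂.β := ⟨lt_min E'.hβin.1 E'₂.hβin.1, min_le_right _ _⟩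
  have h₁ := D.gPieceFin_homotopic_canonP hι hC hv hmem hω hα i hb₁ hb'₁
  have h₂ := D.gPieceFin_homotopic_canonP hι hC₂ hv₂ hmem₂ hω₂ hα₂ i₂ hb₂ hb'₂
  refine h₂.trans ?_
  rw [D.canonP_congr hι hvv (D.bwdTail_j_heq hvv hyy E.Eb E₂.Eb) hvv' (D.fwdTail_j_heq hvv' hyy E'.Ef E'₂.Ef) hyy]
  exact Path.Homotopic.cast' h₁.symm _ _

end Canon2

end StarData

end Literature.Topology.PlanarFoliations
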